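import Mathlib.Analysis.Calculus.BumpFunction.FiniteDimension
import Mathlib.Analysis.Calculus.ContDiff.RCLike
import Mathlib.Analysis.Calculus.UniformLimitsDeriv
import Mathlib.Analysis.ODE.Gronwall
import Literature.Analysis.ODE.LipschitzFlow
import Literature.MathematicalPhysics.KineticTheory.InfiniteChainDynamics
import HarnessLib

/-!
# Lanford–Lebowitz–Lieb 1977, Theorem 1 (strong existence of the infinite-chain dynamics): proof

Topic `Literature/MathematicalPhysics/KineticTheory`; proofs-only companion of
`InfiniteChainDynamics.lean`. It DISCHARGES the named fact
`OscillatorChain.LanfordLebowitzLieb1977_thm1_chain` (O. E. Lanford III, J. L. Lebowitz,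
E. H. Lieb, *Time evolution of infinite anharmonic systems*, J. Stat. Phys. **16** (1977) 453–461,
§2, Theorem 1 with Lemma 1, pp. 455–457) by the theorem
`OscillatorChain.LanfordLebowitzLieb1977_thm1_chain_holds`, following the printed proof:

1. **Severed dynamics (LLL (9a)–(9c)).** `OscillatorChain.sevGlue`, `OscillatorChain.sevField`:
   the equations of motion in a finite box `Λ` with the particles outside `Λ` tied down to `σ₀`,
   a `C¹` vector field on the finite-dimensional space `(ℝ × ℝ)^Λ` (condition A2).
   `OscillatorChain.exists_cutoff_flow`: the field multiplied by a smooth bump function `χ`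
   (`= 1` on the ball of radius `R`) is `C¹` with compact support, hence globally Lipschitz, and
   has a global flow (`Literature.Analysis.ODE.exists_solution_real_of_lipschitz`).
2. **Lemma 1 (a priori bound, LLL (5)–(8)).** `OscillatorChain.siteEnergy_sev_le`: along the
   cut-off severed flow `dℒ_i/dt = χ p_i R_i` (LLL (6)), so by A4 the sup-norm of
   `(e^{-r|i|} ℒ_i + B)_{i ∈ Λ}` has derivative bounded by `3A e^r` times itself, and Grönwall
   (`norm_le_gronwallBound_of_norm_deriv_right_le`, both time directions) gives
   `ℒ_j(t) ≤ 2B e^{3Ae^r |t|} e^{r|j|}` for all `t ∈ ℝ` and all sites, uniformly in `Λ` and in the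
   cut-off — whence (`OscillatorChain.exists_severed_approximant`) for `|t| ≤ n` the motion in
   `Λ_n = {-n, …, n}` stays in the ball where `χ = 1` (A3 bounds `|q_i|`, `ℒ_i` bounds `|p_i|`), i.e.
   the cut-off flow solves the true severed equations on `[-n, n]` ("solutions of (9a)–(9c) are
   prevented from going to infinity in finite time by Lemma 1; they therefore exist for all time").
3. **Compactness.** `OscillatorChain.exists_ultrafilter_tendsto_of_norm_le`: the approximants are
   pointwise bounded (every time, every site), so by Tychonoff they converge pointwise along an
   ultrafilter refining `atTop` — the choice-free packaging of LLL's Arzelà–Ascoli + diagonal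
   subsequence ("the sequence can be further refined to get uniform convergence on every bounded
   interval"); `OscillatorChain.tendstoUniformlyOn_of_equilipschitz` upgrades pointwise to uniform
   convergence on `[-T, T]` for the equi-Lipschitz coordinates.
4. **Passage to the limit.** `OscillatorChain.isSolution_of_tendsto`: positions, momenta and (by
   uniform continuity of `F_j` on the bounded box) forces converge uniformly on `[-T, T]`, so the
   limit solves (1a)–(1b) (`hasDerivAt_of_tendstoUniformlyOn`), and the bound (11),
   `ℒ_j(t) ≤ K' e^{r|j|}` for `|t| ≤ T`, passes to the limit.

No new named facts; everything here is proved. The generic lemmas of §3 are stated for metric /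
proper normed codomains and arbitrary filters.

## References

* O. E. Lanford III, J. L. Lebowitz, E. H. Lieb, *Time evolution of infinite anharmonic systems*,
  J. Stat. Phys. 16 (1977) 453–461, doi:10.1007/bf01152283, §2 (eqs. (1)–(11), Lemma 1, Thm 1).
  [LanfordLebowitzLieb1977]
-/

noncomputable section

open Set Filter Metric Topology
open scoped ContDiff NNReal

namespace Literature.MathematicalPhysics.KineticTheory.HeatConduction

namespace OscillatorChain

variable (P : OscillatorChain)

/-! ## The severed (finite-volume) dynamics, LLL (9a)–(9c) -/

section Severed

variable (Λ : Finset ℤ) (σ₀ : ChainConfig)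

/-- The configuration of the infinite chain obtained from finite-volume data `x ∈ (ℝ × ℝ)^Λ` by
freezing every site outside `Λ` at the reference configuration `σ₀` ("particles outside `Λ`
tied down to their initial positions", LLL 1977 (9c)). [cite: LanfordLebowitzLieb1977, §2 eq. (9c)] -/
def sevGlue (x : Λ → ℝ × ℝ) : ChainConfig := fun i => if h : i ∈ Λ then x ⟨i, h⟩ else σ₀ i

/-- On `Λ` the glued configuration is the finite-volume datum. [folklore] -/
@[simp] theorem sevGlue_apply_of_mem (x : Λ → ℝ × ℝ) {i : ℤ} (h : i ∈ Λ) :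
    sevGlue Λ σ₀ x i = x ⟨i, h⟩ := dif_pos h

/-- Off `Λ` the glued configuration is the reference configuration. [folklore] -/
@[simp] theorem sevGlue_apply_of_not_mem (x : Λ → ℝ × ℝ) {i : ℤ} (h : i ∉ Λ) :
    sevGlue Λ σ₀ x i = σ₀ i := dif_neg h

/-- Gluing the restriction of `σ₀` gives back `σ₀`. [folklore] -/
@[simp] theorem sevGlue_restrict : sevGlue Λ σ₀ (fun i : Λ => σ₀ i) = σ₀ := by
  funext i
  by_cases h : i ∈ Λ <;> simp [h]

/-- The vector field of the severed equations of motion (LLL 1977 (9a)–(9b)) on the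
finite-dimensional phase space `(ℝ × ℝ)^Λ`: `q̇_i = p_i`, `ṗ_i = F_i(q)` for `i ∈ Λ`, the force being
computed in the configuration glued with `σ₀` outside `Λ`. [cite: LanfordLebowitzLieb1977, §2 eqs. (9a)–(9b)] -/
def sevField (x : Λ → ℝ × ℝ) : Λ → ℝ × ℝ := fun i => ((x i).2, P.force (sevGlue Λ σ₀ x) i)

/-- The position coordinates of the glued configuration are smooth in the finite-volume datum.
[folklore] -/
theorem contDiff_sevGlue_fst (j : ℤ) {n : ℕ∞} :
    ContDiff ℝ n fun x : Λ → ℝ × ℝ => (sevGlue Λ σ₀ x j).1 := by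
  by_cases h : j ∈ Λ
  · simp_rw [sevGlue_apply_of_mem Λ σ₀ _ h]
    fun_prop
  · simp_rw [sevGlue_apply_of_not_mem Λ σ₀ _ h]
    exact contDiff_const

variable {P}

/-- `U ∈ C²` gives `U' ∈ C¹`. [folklore] -/
theorem contDiff_one_deriv {f : ℝ → ℝ} (hf : ContDiff ℝ 2 f) : ContDiff ℝ 1 (deriv f) := by
  have h2 : ContDiff ℝ (1 + 1) f := by rwa [one_add_one_eq_two]
  exact h2.deriv'

/-- The severed force is `C¹` in the finite-volume datum when `U, V ∈ C²`. [folklore] -/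
theorem contDiff_force_sevGlue (hU : ContDiff ℝ 2 P.U) (hV : ContDiff ℝ 2 P.V) (i : ℤ) :
    ContDiff ℝ 1 fun x : Λ → ℝ × ℝ => P.force (sevGlue Λ σ₀ x) i := by
  have hU' := contDiff_one_deriv hU
  have hV' := contDiff_one_deriv hV
  simp only [force_eq]
  exact (((hU'.comp (contDiff_sevGlue_fst Λ σ₀ i)).neg.add
    (hV'.comp ((contDiff_sevGlue_fst Λ σ₀ (i + 1)).sub (contDiff_sevGlue_fst Λ σ₀ i)))).sub
    (hV'.comp ((contDiff_sevGlue_fst Λ σ₀ i).sub (contDiff_sevGlue_fst Λ σ₀ (i - 1)))))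

/-- The severed vector field is `C¹` when `U, V ∈ C²` (LLL condition A2). [folklore] -/
theorem contDiff_sevField (hU : ContDiff ℝ 2 P.U) (hV : ContDiff ℝ 2 P.V) :
    ContDiff ℝ 1 (P.sevField Λ σ₀) := by
  refine contDiff_pi' fun i => ?_
  refine ContDiff.prodMk ?_ (contDiff_force_sevGlue Λ σ₀ hU hV i)
  fun_prop

/-- **Global flow of the cut-off severed system.** For every radius `R > 0` there is a curve
`y : ℝ → (ℝ × ℝ)^Λ` through `x₀`, defined for all times, solving `ẏ = θ(t) · X(y)` where `X` is
the severed field, `0 ≤ θ ≤ 1`, and `θ(t) = 1` whenever `‖y t‖ ≤ R` (the field multiplied by a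
smooth bump function equal to `1` on the ball of radius `R` is `C¹` with compact support, hence
globally Lipschitz, so `Literature.Analysis.ODE.exists_solution_real_of_lipschitz` applies). [folklore] -/
theorem exists_cutoff_flow (hU : ContDiff ℝ 2 P.U) (hV : ContDiff ℝ 2 P.V) {R : ℝ} (hR : 0 < R)
    (x₀ : Λ → ℝ × ℝ) :
    ∃ y : ℝ → (Λ → ℝ × ℝ), y 0 = x₀ ∧ ∃ θ : ℝ → ℝ, (∀ t, θ t ∈ Icc (0 : ℝ) 1) ∧
      (∀ t, ‖y t‖ ≤ R → θ t = 1) ∧ ∀ t, HasDerivAt y (θ t • P.sevField Λ σ₀ (y t)) t := by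
  let χ : ContDiffBump (0 : Λ → ℝ × ℝ) := ⟨R, R + 1, hR, by linarith⟩
  have hF : ContDiff ℝ 1 fun x => χ x • P.sevField Λ σ₀ x :=
    χ.contDiff.smul (contDiff_sevField Λ σ₀ hU hV)
  have hsupp : HasCompactSupport fun x => χ x • P.sevField Λ σ₀ x :=
    χ.hasCompactSupport.smul_right
  obtain ⟨C, hC⟩ := hF.lipschitzWith_of_hasCompactSupport hsupp one_ne_zero
  obtain ⟨y, hy0, hy⟩ := Literature.Analysis.ODE.exists_solution_real_of_lipschitz hC x₀
  refine ⟨y, hy0, fun t => χ (y t), fun t => ⟨χ.nonneg, χ.le_one⟩, fun t ht => ?_, hy⟩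
  exact χ.one_of_mem_closedBall (by simpa using ht)

end Severed

/-! ## LLL Lemma 1: the a priori bound for the (cut-off) severed dynamics -/

section APriori

variable {P}
variable {Λ : Finset ℤ} {σ₀ : ChainConfig}

/-- First component of a differentiable curve in `ℝ × ℝ`. [folklore] -/
theorem hasDerivAt_fst_comp {f : ℝ → ℝ × ℝ} {f' : ℝ × ℝ} {x : ℝ} (h : HasDerivAt f f' x) :
    HasDerivAt (fun t => (f t).1) f'.1 x := by
  have := (ContinuousLinearMap.fst ℝ ℝ ℝ).hasFDerivAt.comp_hasDerivAt x h
  simpa [Function.comp_def] using this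

/-- Second component of a differentiable curve in `ℝ × ℝ`. [folklore] -/
theorem hasDerivAt_snd_comp {f : ℝ → ℝ × ℝ} {f' : ℝ × ℝ} {x : ℝ} (h : HasDerivAt f f' x) :
    HasDerivAt (fun t => (f t).2) f'.2 x := by
  have := (ContinuousLinearMap.snd ℝ ℝ ℝ).hasFDerivAt.comp_hasDerivAt x h
  simpa [Function.comp_def] using this

/-- The site energy only depends on the configuration at the site. [folklore] -/
theorem siteEnergy_congr (K : ℝ) {σ σ' : ChainConfig} {i : ℤ} (h : σ i = σ' i) :
    P.siteEnergy K σ i = P.siteEnergy K σ' i := by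
  simp [siteEnergy, h]

/-- Off `Λ` the site energies of the glued configuration are those of `σ₀`. [folklore] -/
theorem siteEnergy_sevGlue_of_not_mem (K : ℝ) (x : Λ → ℝ × ℝ) {i : ℤ} (h : i ∉ Λ) :
    P.siteEnergy K (sevGlue Λ σ₀ x) i = P.siteEnergy K σ₀ i :=
  siteEnergy_congr K (sevGlue_apply_of_not_mem Λ σ₀ x h)

/-- Components of a solution of the cut-off severed system `ẏ = θ(t) X(y)`:
`q̇_i = θ p_i`, `ṗ_i = θ F_i`. [folklore] -/
theorem hasDerivAt_sev_components {y : ℝ → (Λ → ℝ × ℝ)} {θ : ℝ → ℝ} {t : ℝ}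
    (hy : HasDerivAt y (θ t • P.sevField Λ σ₀ (y t)) t) (i : Λ) :
    HasDerivAt (fun s => (y s i).1) (θ t * (y t i).2) t ∧
      HasDerivAt (fun s => (y s i).2) (θ t * P.force (sevGlue Λ σ₀ (y t)) i) t := by
  have h := hasDerivAt_pi.mp hy i
  exact ⟨by simpa [sevField] using hasDerivAt_fst_comp h,
    by simpa [sevField] using hasDerivAt_snd_comp h⟩

/-- Along the cut-off severed flow, `dℒ_i/dt = θ p_i R_i` for `i ∈ Λ` (LLL 1977, eq. (6), with the
cut-off factor `θ`). [cite: LanfordLebowitzLieb1977, §2 eq. (6)] -/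
theorem hasDerivAt_siteEnergy_sev (hU : ContDiff ℝ 2 P.U) (K : ℝ) {y : ℝ → (Λ → ℝ × ℝ)}
    {θ : ℝ → ℝ} {t : ℝ} (hy : HasDerivAt y (θ t • P.sevField Λ σ₀ (y t)) t) {i : ℤ} (hi : i ∈ Λ) :
    HasDerivAt (fun s => P.siteEnergy K (sevGlue Λ σ₀ (y s)) i)
      (θ t * ((sevGlue Λ σ₀ (y t) i).2 * P.interactionForce (sevGlue Λ σ₀ (y t)) i)) t := by
  obtain ⟨hq, hp⟩ := hasDerivAt_sev_components hy ⟨i, hi⟩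
  have hUd : ∀ x, HasDerivAt P.U (deriv P.U x) x := fun x =>
    ((hU.differentiable (by norm_num)) x).hasDerivAt
  have hfun : (fun s => P.siteEnergy K (sevGlue Λ σ₀ (y s)) i) = fun s =>
      (y s ⟨i, hi⟩).2 * (y s ⟨i, hi⟩).2 / 2 + P.U (y s ⟨i, hi⟩).1 + K := by
    funext s
    simp [siteEnergy, sevGlue_apply_of_mem Λ σ₀ _ hi, pow_two]
  rw [hfun]
  refine ((((hp.mul hp).div_const 2).add ((hUd _).comp t hq)).add_const K).congr_deriv ?_
  simp only [sevGlue_apply_of_mem Λ σ₀ _ hi, force]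
  ring

/-- **LLL 1977, Lemma 1 (a priori bound), for the cut-off severed chain dynamics.** Under A4
(`|p_i R_i| ≤ A (ℒ_{i-1} + ℒ_i + ℒ_{i+1})`, `ℒ ≥ 0`) and `ℒ_j(σ₀) ≤ B e^{r|j|}`, every solution of
`ẏ = θ(t) X(y)` (`0 ≤ θ ≤ 1`, `X` the severed field in `Λ`, data `σ₀|_Λ`) satisfies
`ℒ_j(t) ≤ 2B e^{3A e^r |t|} e^{r|j|}` for all `t ∈ ℝ` and all sites `j` (Grönwall for the sup-norm
of `(e^{-r|i|} ℒ_i + B)_{i ∈ Λ}`, whose derivative is bounded by `3A e^r` times itself; LLL's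
`‖ℒ(t)‖_r ≤ e^{at} ‖ℒ(0)‖_r`, eq. (5)). [cite: LanfordLebowitzLieb1977, §2 Lemma 1] -/
theorem siteEnergy_sev_le (hU : ContDiff ℝ 2 P.U) {K A : ℝ}
    (hK0 : ∀ (σ : ChainConfig) (i : ℤ), 0 ≤ P.siteEnergy K σ i) (hA : 0 ≤ A)
    (hA4 : ∀ (σ : ChainConfig) (i : ℤ), |(σ i).2 * P.interactionForce σ i| ≤
      A * (P.siteEnergy K σ (i - 1) + P.siteEnergy K σ i + P.siteEnergy K σ (i + 1)))
    {r : ℝ} (hr : 0 ≤ r) {B : ℝ} (hB : ∀ j : ℤ, P.siteEnergy K σ₀ j ≤ B * Real.exp (r * |(j : ℝ)|))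
    {y : ℝ → (Λ → ℝ × ℝ)} {θ : ℝ → ℝ} (hθ : ∀ t, θ t ∈ Icc (0 : ℝ) 1)
    (hy : ∀ t, HasDerivAt y (θ t • P.sevField Λ σ₀ (y t)) t) (hy0 : y 0 = fun i : Λ => σ₀ i)
    (t : ℝ) (j : ℤ) :
    P.siteEnergy K (sevGlue Λ σ₀ (y t)) j ≤
      2 * B * Real.exp (3 * A * Real.exp r * |t|) * Real.exp (r * |(j : ℝ)|) := by
  have hB0 : 0 ≤ B := by
    have := (hK0 σ₀ 0).trans (hB 0)
    simpa using this
  -- weights `w_k = e^{-r|k|}`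
  set w : ℤ → ℝ := fun k => Real.exp (-(r * |(k : ℝ)|)) with hw
  have hw_pos : ∀ k, 0 < w k := fun k => Real.exp_pos _
  have hw_mul : ∀ k, w k * Real.exp (r * |(k : ℝ)|) = 1 := fun k => by
    simp only [hw, Real.exp_neg, inv_mul_cancel₀ (Real.exp_pos _).ne']
  -- abbreviation for the energies along the flow
  set E : ℝ → ℤ → ℝ := fun s k => P.siteEnergy K (sevGlue Λ σ₀ (y s)) k with hE
  have hE0 : ∀ s k, 0 ≤ E s k := fun s k => hK0 _ _
  -- the Grönwall function and its derivative
  set g : ℝ → (Λ → ℝ) := fun s i => w i * E s i + B with hg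
  set g' : ℝ → (Λ → ℝ) := fun s i => w i * (θ s * ((sevGlue Λ σ₀ (y s) i).2 *
    P.interactionForce (sevGlue Λ σ₀ (y s)) i)) with hg'
  have hgd : ∀ s, HasDerivAt g (g' s) s := fun s =>
    hasDerivAt_pi.mpr fun i =>
      ((hasDerivAt_siteEnergy_sev hU K (hy s) i.2).const_mul (w i)).add_const B
  have hg_nonneg : ∀ s i, 0 ≤ g s i := fun s i => by
    simp only [hg]
    exact add_nonneg (mul_nonneg (hw_pos i).le (hE0 s i)) hB0
  have hg_le_norm : ∀ s (i : Λ), g s i ≤ ‖g s‖ := fun s i =>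
    (le_abs_self _).trans (by simpa only [Real.norm_eq_abs] using norm_le_pi_norm (g s) i)
  -- weighted energies at every site are bounded by `‖g s‖` (given some `i ∈ Λ`)
  have hkey : ∀ s (i : Λ) (k : ℤ), w k * E s k ≤ ‖g s‖ := by
    intro s i k
    by_cases hk : k ∈ Λ
    · have h1 := hg_le_norm s ⟨k, hk⟩
      simp only [hg] at h1
      linarith
    · have h2 : w k * E s k ≤ B := by
        calc w k * E s k = w k * P.siteEnergy K σ₀ k := by
              simp only [hE, siteEnergy_sevGlue_of_not_mem K _ hk]
          _ ≤ w k * (B * Real.exp (r * |(k : ℝ)|)) :=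
              mul_le_mul_of_nonneg_left (hB k) (hw_pos k).le
          _ = B * (w k * Real.exp (r * |(k : ℝ)|)) := by ring
          _ = B := by rw [hw_mul, mul_one]
      have h3 : B ≤ g s i := by
        simp only [hg]
        linarith [mul_nonneg (hw_pos i).le (hE0 s i)]
      exact h2.trans (h3.trans (hg_le_norm s i))
  -- `‖g'‖ ≤ 3 A e^r ‖g‖`
  set κ : ℝ := 3 * A * Real.exp r with hκ
  have hκ0 : 0 ≤ κ := by positivity
  have hbound : ∀ s, ‖g' s‖ ≤ κ * ‖g s‖ := by
    intro s
    refine (pi_norm_le_iff_of_nonneg (by positivity)).mpr fun i => ?_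
    have hθs := hθ s
    have hnb : ∀ k : ℤ, |(k : ℝ) - (i : ℤ)| ≤ 1 → w i * E s k ≤ Real.exp r * ‖g s‖ := by
      intro k hk
      have hwk : w i ≤ Real.exp r * w k := by
        have h1 : |(k : ℝ)| - |((i : ℤ) : ℝ)| ≤ 1 := (abs_sub_abs_le_abs_sub _ _).trans hk
        have h2 : -(r * |((i : ℤ) : ℝ)|) ≤ r + -(r * |(k : ℝ)|) := by nlinarith
        calc w i = Real.exp (-(r * |((i : ℤ) : ℝ)|)) := rfl
          _ ≤ Real.exp (r + -(r * |(k : ℝ)|)) := Real.exp_le_exp.mpr h2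
          _ = Real.exp r * w k := by rw [Real.exp_add]
      calc w i * E s k ≤ Real.exp r * w k * E s k :=
            mul_le_mul_of_nonneg_right hwk (hE0 s k)
        _ = Real.exp r * (w k * E s k) := by ring
        _ ≤ Real.exp r * ‖g s‖ :=
            mul_le_mul_of_nonneg_left (hkey s i k) (Real.exp_pos _).le
    have h1 := hnb ((i : ℤ) - 1) (by push_cast; norm_num)
    have h2 := hnb (i : ℤ) (by simp)
    have h3 := hnb ((i : ℤ) + 1) (by push_cast; norm_num)
    have h4 := hA4 (sevGlue Λ σ₀ (y s)) i
    rw [Real.norm_eq_abs]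
    simp only [hg']
    rw [abs_mul, abs_mul, abs_of_pos (hw_pos i), abs_of_nonneg hθs.1]
    calc w i * (θ s * |(sevGlue Λ σ₀ (y s) i).2 * P.interactionForce (sevGlue Λ σ₀ (y s)) i|)
        ≤ w i * (1 * (A * (E s (i - 1) + E s i + E s (i + 1)))) := by
          apply mul_le_mul_of_nonneg_left _ (hw_pos i).le
          exact mul_le_mul hθs.2 h4 (abs_nonneg _) zero_le_one
      _ = A * (w i * E s (i - 1) + w i * E s i + w i * E s (i + 1)) := by ring
      _ ≤ A * (Real.exp r * ‖g s‖ + Real.exp r * ‖g s‖ + Real.exp r * ‖g s‖) := by gcongr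
      _ = κ * ‖g s‖ := by simp only [hκ]; ring
  -- `‖g 0‖ ≤ 2B`
  have hg0 : ‖g 0‖ ≤ 2 * B := by
    refine (pi_norm_le_iff_of_nonneg (by positivity)).mpr fun i => ?_
    rw [Real.norm_eq_abs, abs_of_nonneg (hg_nonneg 0 i)]
    have h1 : E 0 i = P.siteEnergy K σ₀ i := by
      simp only [hE, hy0, sevGlue_restrict]
    simp only [hg, h1]
    calc w i * P.siteEnergy K σ₀ i + B ≤ w i * (B * Real.exp (r * |((i : ℤ) : ℝ)|)) + B := by
          have := mul_le_mul_of_nonneg_left (hB i) (hw_pos i).le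
          linarith
      _ = B * (w i * Real.exp (r * |((i : ℤ) : ℝ)|)) + B := by ring
      _ = 2 * B := by rw [hw_mul]; ring
  -- Grönwall in both time directions
  have hgron : ∀ s, ‖g s‖ ≤ 2 * B * Real.exp (κ * |s|) := by
    intro s
    rcases le_or_gt 0 s with hs | hs
    · have h := norm_le_gronwallBound_of_norm_deriv_right_le (f := g) (f' := g') (a := 0)
        (b := s) (δ := 2 * B) (K := κ) (ε := 0)
        (fun u _ => (hgd u).continuousAt.continuousWithinAt)
        (fun u _ => (hgd u).hasDerivWithinAt) hg0 (fun u _ => by simpa using hbound u)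
        s ⟨hs, le_rfl⟩
      rw [gronwallBound_ε0, sub_zero] at h
      rw [abs_of_nonneg hs]
      exact h
    · have hGd : ∀ u, HasDerivAt (fun u => g (-u)) (-(g' (-u))) u := fun u => by
        have := (hgd (-u)).scomp u (hasDerivAt_neg u)
        simpa [Function.comp_def] using this
      have h := norm_le_gronwallBound_of_norm_deriv_right_le (f := fun u => g (-u))
        (f' := fun u => -(g' (-u))) (a := 0) (b := -s) (δ := 2 * B) (K := κ) (ε := 0)
        (fun u _ => (hGd u).continuousAt.continuousWithinAt)
        (fun u _ => (hGd u).hasDerivWithinAt) (by simpa using hg0)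
        (fun u _ => by simpa [norm_neg] using hbound (-u)) (-s) ⟨by linarith, le_rfl⟩
      simp only [gronwallBound_ε0, sub_zero, neg_neg] at h
      rw [abs_of_neg hs]
      exact h
  -- conclusion
  by_cases hj : j ∈ Λ
  · have h1 : w j * E t j ≤ ‖g t‖ := hkey t ⟨j, hj⟩ j
    calc P.siteEnergy K (sevGlue Λ σ₀ (y t)) j = E t j := rfl
      _ = Real.exp (r * |(j : ℝ)|) * (w j * E t j) := by
          rw [← mul_assoc, mul_comm (Real.exp _), hw_mul, one_mul]
      _ ≤ Real.exp (r * |(j : ℝ)|) * ‖g t‖ :=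
          mul_le_mul_of_nonneg_left h1 (Real.exp_pos _).le
      _ ≤ Real.exp (r * |(j : ℝ)|) * (2 * B * Real.exp (κ * |t|)) :=
          mul_le_mul_of_nonneg_left (hgron t) (Real.exp_pos _).le
      _ = 2 * B * Real.exp (κ * |t|) * Real.exp (r * |(j : ℝ)|) := by ring
  · rw [siteEnergy_sevGlue_of_not_mem K _ hj]
    have hexp1 : 1 ≤ Real.exp (κ * |t|) := Real.one_le_exp (by positivity)
    calc P.siteEnergy K σ₀ j ≤ B * Real.exp (r * |(j : ℝ)|) := hB j
      _ = B * 1 * Real.exp (r * |(j : ℝ)|) := by ring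
      _ ≤ 2 * B * Real.exp (κ * |t|) * Real.exp (r * |(j : ℝ)|) := by
          gcongr
          linarith

end APriori

/-! ## The severed approximants `σ^n` (LLL (10a)–(10c)) with the a priori bound -/

section Approximants

variable {P}
variable {σ₀ : ChainConfig}

/-- The boxes `Λ_n = {-n, …, n} ⊂ ℤ` exhausting the lattice. [folklore] -/
def box (n : ℕ) : Finset ℤ := Finset.Icc (-(n : ℤ)) n

/-- Sites of `Λ_n` have `|i| ≤ n`. [folklore] -/
theorem abs_le_of_mem_box {n : ℕ} {i : ℤ} (h : i ∈ box n) : |(i : ℝ)| ≤ n := by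
  simp only [box, Finset.mem_Icc] at h
  rw [abs_le]
  exact ⟨by exact_mod_cast h.1, by exact_mod_cast h.2⟩

/-- Sites with `|i| ≤ n` belong to `Λ_n`. [folklore] -/
theorem mem_box_of_abs_le {n : ℕ} {i : ℤ} (h : |(i : ℝ)| ≤ n) : i ∈ box n := by
  simp only [box, Finset.mem_Icc]
  obtain ⟨h1, h2⟩ := abs_le.mp h
  exact ⟨by exact_mod_cast h1, by exact_mod_cast h2⟩

/-- `|p_i| ≤ 1 + 2 ℒ_i` (from `ℒ_i = ½ p_i² + (U(q_i) + K)` with `U + K ≥ 0`). [folklore] -/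
theorem abs_snd_le_siteEnergy {K : ℝ} (hK0 : ∀ (σ : ChainConfig) (i : ℤ), 0 ≤ P.siteEnergy K σ i)
    (σ : ChainConfig) (i : ℤ) : |(σ i).2| ≤ 1 + 2 * P.siteEnergy K σ i := by
  have h1 : 0 ≤ P.U (σ i).1 + K := by
    have := hK0 (fun _ => ((σ i).1, 0)) 0
    simpa [siteEnergy, add_assoc] using this
  have h2 : P.siteEnergy K σ i = (σ i).2 ^ 2 / 2 + (P.U (σ i).1 + K) := by
    simp only [siteEnergy]
    ring
  nlinarith [abs_nonneg ((σ i).2), sq_abs ((σ i).2), sq_nonneg (|(σ i).2| - 1)]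

/-- `|q_i| ≤ C₁ (ℒ_i + |K|) + C₂` under LLL's condition A3 `|q| ≤ C₁ U(q) + C₂`. [folklore] -/
theorem abs_fst_le_siteEnergy {K C₁ C₂ : ℝ} (hC₁ : 0 ≤ C₁) (hA3 : ∀ q : ℝ, |q| ≤ C₁ * P.U q + C₂)
    (σ : ChainConfig) (i : ℤ) : |(σ i).1| ≤ C₁ * (P.siteEnergy K σ i + |K|) + C₂ := by
  have h1 := hA3 (σ i).1
  have h2 : P.U (σ i).1 ≤ P.siteEnergy K σ i + |K| := by
    simp only [siteEnergy]
    nlinarith [sq_nonneg (σ i).2, le_abs_self K, neg_abs_le K]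
  nlinarith [mul_le_mul_of_nonneg_left h2 hC₁]

/-- Monotonicity of the bound `2B e^{κ|s|} e^{ra}` in `|s|` and `a`. [folklore] -/
theorem expBound_mono {B κ r : ℝ} (hB : 0 ≤ B) (hκ : 0 ≤ κ) (hr : 0 ≤ r) {s t a b : ℝ}
    (hst : |s| ≤ t) (hab : a ≤ b) :
    2 * B * Real.exp (κ * |s|) * Real.exp (r * a) ≤ 2 * B * Real.exp (κ * t) * Real.exp (r * b) :=
  mul_le_mul (mul_le_mul_of_nonneg_left (Real.exp_le_exp.mpr (mul_le_mul_of_nonneg_left hst hκ))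
    (by linarith)) (Real.exp_le_exp.mpr (mul_le_mul_of_nonneg_left hab hr)) (Real.exp_pos _).le
    (mul_nonneg (by linarith) (Real.exp_pos _).le)

/-- **The severed approximants (LLL 1977, proof of Thm 1, eqs. (9a)–(10c)).** Under A2–A4 and
`ℒ_j(σ₀) ≤ B e^{r|j|}`, for every `n` there is a curve `σ^n : ℝ → (ℝ × ℝ)^ℤ` with `σ^n(0) = σ₀`
which on the time interval `[-n, n]` solves the severed equations in `Λ_n = {-n, …, n}` (sites
outside `Λ_n` frozen at `σ₀`) and satisfies the a priori bound `ℒ_j(σ^n(t)) ≤ 2B e^{3Ae^r|t|} e^{r|j|}`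
for all `t` and `j` (it is the global flow of the severed field cut off outside the ball that the
a priori bound confines the motion to for `|t| ≤ n`; "solutions of (9a)–(9c) are prevented from
going to infinity in finite time by Lemma 1; they therefore exist for all time"). [cite: LanfordLebowitzLieb1977, §2 proof of Thm 1] -/
theorem exists_severed_approximant (hU : ContDiff ℝ 2 P.U) (hV : ContDiff ℝ 2 P.V)
    {C₁ C₂ : ℝ} (hC₁ : 0 ≤ C₁) (hA3 : ∀ q : ℝ, |q| ≤ C₁ * P.U q + C₂)
    {K A : ℝ} (hK0 : ∀ (σ : ChainConfig) (i : ℤ), 0 ≤ P.siteEnergy K σ i) (hA : 0 ≤ A)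
    (hA4 : ∀ (σ : ChainConfig) (i : ℤ), |(σ i).2 * P.interactionForce σ i| ≤
      A * (P.siteEnergy K σ (i - 1) + P.siteEnergy K σ i + P.siteEnergy K σ (i + 1)))
    {r : ℝ} (hr : 0 ≤ r) {B : ℝ} (hB : ∀ j : ℤ, P.siteEnergy K σ₀ j ≤ B * Real.exp (r * |(j : ℝ)|))
    (n : ℕ) :
    ∃ y : ℝ → ChainConfig, y 0 = σ₀ ∧
      (∀ (t : ℝ) (j : ℤ), P.siteEnergy K (y t) j ≤
        2 * B * Real.exp (3 * A * Real.exp r * |t|) * Real.exp (r * |(j : ℝ)|)) ∧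
      ∀ t ∈ Icc (-(n : ℝ)) n, ∀ i ∈ box n,
        HasDerivAt (fun s => (y s i).1) (y t i).2 t ∧
          HasDerivAt (fun s => (y s i).2) (P.force (y t) i) t := by
  have hB0 : 0 ≤ B := by
    have := (hK0 σ₀ 0).trans (hB 0)
    simpa using this
  set κ : ℝ := 3 * A * Real.exp r with hκ
  have hκ0 : 0 ≤ κ := by positivity
  -- the a priori energy level on `[-n, n] × Λ_n` and the resulting confinement radius
  set ℰ : ℝ := 2 * B * Real.exp (κ * n) * Real.exp (r * n) with hℰ
  have hℰ0 : 0 ≤ ℰ := by positivity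
  set R : ℝ := max (1 + 2 * ℰ) (C₁ * (ℰ + |K|) + C₂) with hR
  have hRpos : 0 < R := lt_of_lt_of_le (by linarith) (le_max_left _ _)
  obtain ⟨y, hy0, θ, hθ, hθ1, hy⟩ :=
    exists_cutoff_flow (P := P) (box n) σ₀ hU hV hRpos (fun i => σ₀ i)
  have hE : ∀ t j, P.siteEnergy K (sevGlue (box n) σ₀ (y t)) j ≤
      2 * B * Real.exp (κ * |t|) * Real.exp (r * |(j : ℝ)|) :=
    siteEnergy_sev_le hU hK0 hA hA4 hr hB hθ hy hy0
  refine ⟨fun t => sevGlue (box n) σ₀ (y t), by simp [hy0], hE, ?_⟩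
  intro t ht i hi
  -- for `|t| ≤ n` the trajectory is inside the ball of radius `R`, where the cut-off is inactive
  have htn : |t| ≤ n := abs_le.mpr ⟨by linarith [ht.1], ht.2⟩
  have hyt : ‖y t‖ ≤ R := by
    refine (pi_norm_le_iff_of_nonneg hRpos.le).mpr fun k => ?_
    have hk : (k : ℤ) ∈ box n := k.2
    have hEk : P.siteEnergy K (sevGlue (box n) σ₀ (y t)) k ≤ ℰ :=
      (hE t k).trans (expBound_mono hB0 hκ0 hr htn (abs_le_of_mem_box hk))
    have hq := abs_fst_le_siteEnergy (K := K) hC₁ hA3 (sevGlue (box n) σ₀ (y t)) k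
    have hp := abs_snd_le_siteEnergy hK0 (sevGlue (box n) σ₀ (y t)) k
    simp only [sevGlue_apply_of_mem _ _ _ hk, Subtype.coe_eta] at hq hp
    rw [Prod.norm_def, Real.norm_eq_abs, Real.norm_eq_abs]
    refine max_le ?_ ?_
    · calc |(y t k).1| ≤ C₁ * (P.siteEnergy K (sevGlue (box n) σ₀ (y t)) k + |K|) + C₂ := hq
        _ ≤ C₁ * (ℰ + |K|) + C₂ := by nlinarith [mul_le_mul_of_nonneg_left hEk hC₁]
        _ ≤ R := le_max_right _ _
    · calc |(y t k).2| ≤ 1 + 2 * P.siteEnergy K (sevGlue (box n) σ₀ (y t)) k := hp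
        _ ≤ 1 + 2 * ℰ := by linarith
        _ ≤ R := le_max_left _ _
  have hθt : θ t = 1 := hθ1 t hyt
  have hyt' : HasDerivAt y ((fun _ : ℝ => (1 : ℝ)) t • P.sevField (box n) σ₀ (y t)) t := by
    simpa [hθt] using hy t
  obtain ⟨hq, hp⟩ :=
    hasDerivAt_sev_components (y := y) (θ := fun _ : ℝ => (1 : ℝ)) (t := t) hyt' ⟨i, hi⟩
  simp only [one_mul] at hq hp
  exact ⟨by simpa [sevGlue_apply_of_mem _ _ _ hi] using hq,
    by simpa [sevGlue_apply_of_mem _ _ _ hi] using hp⟩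

end Approximants

/-! ## Compactness and passage to the limit `Λ_n ↑ ℤ` -/

section Limit

/-- **Equi-Lipschitz families converge uniformly where they converge pointwise** (the
Arzelà–Ascoli mechanism on a compact interval, along an arbitrary filter): if eventually every
`F_n` is `L`-Lipschitz on `[a, b]` and `F_n → f` pointwise on `[a, b]`, then `F_n → f` uniformly on
`[a, b]`. [folklore] -/
theorem tendstoUniformlyOn_of_equilipschitz {ι β : Type*} [PseudoMetricSpace β] {l : Filter ι}
    [NeBot l] {F : ι → ℝ → β} {f : ℝ → β} {a b L : ℝ}
    (hF : ∀ᶠ n in l, ∀ x ∈ Icc a b, ∀ y ∈ Icc a b, dist (F n x) (F n y) ≤ L * dist x y)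
    (hf : ∀ x ∈ Icc a b, Tendsto (fun n => F n x) l (𝓝 (f x))) :
    TendstoUniformlyOn F f l (Icc a b) := by
  have hF' : ∀ᶠ n in l, ∀ x ∈ Icc a b, ∀ y ∈ Icc a b, dist (F n x) (F n y) ≤ |L| * dist x y :=
    hF.mono fun n hn x hx y hy =>
      (hn x hx y hy).trans (mul_le_mul_of_nonneg_right (le_abs_self L) dist_nonneg)
  have hL : ∀ x ∈ Icc a b, ∀ y ∈ Icc a b, dist (f x) (f y) ≤ |L| * dist x y :=
    fun x hx y hy =>
      le_of_tendsto ((hf x hx).dist (hf y hy)) (hF'.mono fun n hn => hn x hx y hy)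
  rw [Metric.tendstoUniformlyOn_iff]
  intro ε hε
  set δ : ℝ := ε / (3 * (|L| + 1)) with hδ
  have hδ0 : 0 < δ := by positivity
  have hδε : |L| * δ ≤ ε / 3 := by
    have h3 : (0 : ℝ) < 3 * (|L| + 1) := by positivity
    rw [hδ, mul_div_assoc', div_le_div_iff₀ h3 (by norm_num : (0 : ℝ) < 3)]
    nlinarith [abs_nonneg L]
  obtain ⟨T, hTs, hTf, hcover⟩ := finite_cover_balls_of_compact (isCompact_Icc (a := a) (b := b)) hδ0
  have hev : ∀ᶠ n in l, ∀ y ∈ T, dist (F n y) (f y) < ε / 3 :=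
    (eventually_all_finite hTf).mpr fun y hy =>
      Metric.tendsto_nhds.mp (hf y (hTs hy)) (ε / 3) (by positivity)
  filter_upwards [hF', hev] with n hn hn' x hx
  obtain ⟨y, hy, hxy⟩ := mem_iUnion₂.mp (hcover hx)
  have hyI : y ∈ Icc a b := hTs hy
  have hxy' : dist x y < δ := mem_ball.mp hxy
  have h1 : |L| * dist x y ≤ ε / 3 :=
    (mul_le_mul_of_nonneg_left hxy'.le (abs_nonneg L)).trans hδε
  have h2 : dist (f y) (F n y) < ε / 3 := by
    rw [dist_comm]
    exact hn' y hy
  calc dist (f x) (F n x) ≤ dist (f x) (f y) + dist (f y) (F n y) + dist (F n y) (F n x) :=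
        dist_triangle4 _ _ _ _
    _ ≤ |L| * dist x y + dist (f y) (F n y) + |L| * dist y x := by
        gcongr ?_ + _ + ?_
        · exact hL x hx y hyI
        · exact hn y hyI x hx
    _ < ε := by
        rw [dist_comm y x]
        linarith

/-- Uniform convergence of a pair of families along the same filter (metric codomains).
[folklore] -/
theorem tendstoUniformlyOn_prodMk {ι α β γ : Type*} [PseudoMetricSpace β] [PseudoMetricSpace γ]
    {l : Filter ι} {s : Set α} {F : ι → α → β} {f : α → β} {G : ι → α → γ} {g : α → γ}
    (hF : TendstoUniformlyOn F f l s) (hG : TendstoUniformlyOn G g l s) :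
    TendstoUniformlyOn (fun n x => (F n x, G n x)) (fun x => (f x, g x)) l s := by
  rw [Metric.tendstoUniformlyOn_iff] at hF hG ⊢
  intro ε hε
  filter_upwards [hF ε hε, hG ε hε] with n hn hn' x hx
  rw [Prod.dist_eq]
  exact max_lt (hn x hx) (hn' x hx)

/-- **Compactness (Tychonoff) for pointwise bounded sequences of maps into a proper space.** A
sequence `u_n : α → E` with `‖u_n x‖ ≤ ρ(x)` has a pointwise limit `v` (with the same bounds) along
some ultrafilter refining `atTop` — the choice-free form of "a subsequence converging at every
point" that replaces the diagonal argument of LLL's proof. [folklore] -/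
theorem exists_ultrafilter_tendsto_of_norm_le {α E : Type*} [NormedAddCommGroup E]
    [ProperSpace E] {u : ℕ → α → E} {ρ : α → ℝ} (h : ∀ n x, ‖u n x‖ ≤ ρ x) :
    ∃ (𝒰 : Ultrafilter ℕ) (v : α → E), (𝒰 : Filter ℕ) ≤ atTop ∧ (∀ x, ‖v x‖ ≤ ρ x) ∧
      ∀ x, Tendsto (fun n => u n x) (𝒰 : Filter ℕ) (𝓝 (v x)) := by
  set S : Set (α → E) := Set.pi univ fun x => closedBall (0 : E) (ρ x) with hS
  have hSc : IsCompact S := isCompact_univ_pi fun x => isCompact_closedBall (0 : E) (ρ x)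
  let 𝒰 : Ultrafilter ℕ := Ultrafilter.of atTop
  have h𝒰 : (𝒰 : Filter ℕ) ≤ atTop := Ultrafilter.of_le atTop
  have hmem : ∀ n, u n ∈ S := fun n => mem_univ_pi.mpr fun x => by simpa using h n x
  have hle : ((𝒰.map u : Ultrafilter (α → E)) : Filter (α → E)) ≤ 𝓟 S := by
    rw [le_principal_iff, Ultrafilter.coe_map]
    exact mem_map.mpr (univ_mem' hmem)
  obtain ⟨v, hvS, hv⟩ := hSc.ultrafilter_le_nhds (𝒰.map u) hle
  refine ⟨𝒰, v, h𝒰, fun x => ?_, fun x => ?_⟩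
  · simpa using mem_univ_pi.mp hvS x
  · have h1 : Tendsto u (𝒰 : Filter ℕ) (𝓝 v) := by
      rw [Tendsto, ← Ultrafilter.coe_map]
      exact hv
    exact tendsto_pi_nhds.mp h1 x

variable {P}

/-- **Passage to the limit in the severed equations (LLL 1977, proof of Thm 1).** Let
`σ^n : ℝ → (ℝ × ℝ)^ℤ` converge pointwise (every time, every site) along a filter to `σ`, with bounds
`‖σ^n_j(t)‖ ≤ ρ_j(t)` monotone in `|t|`, and suppose that for every `T` and `j`, eventually
`σ^n_j` solves the `j`-th pair of equations of motion on `[-T, T]`. Then `σ` solves (1a)–(1b) for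
all times: positions and momenta are equi-Lipschitz on `[-T, T]` (bounded derivatives), hence
converge uniformly there, the forces `F_j(σ^n(t))` converge uniformly by uniform continuity of
`(q_{j-1}, q_j, q_{j+1}) ↦ F_j` on the bounded box, and derivatives pass to uniform limits
(`hasDerivAt_of_tendstoUniformlyOn`). [cite: LanfordLebowitzLieb1977, §2 proof of Thm 1] -/
theorem isSolution_of_tendsto (hUc : Continuous (deriv P.U)) (hVc : Continuous (deriv P.V))
    {ι : Type*} {l : Filter ι} [NeBot l] {y : ι → ℝ → ChainConfig} {v : ℝ → ChainConfig}
    (hv : ∀ (t : ℝ) (j : ℤ), Tendsto (fun n => y n t j) l (𝓝 (v t j)))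
    {ρ : ℝ → ℤ → ℝ} (hρ : ∀ n t j, ‖y n t j‖ ≤ ρ t j)
    (hρm : ∀ (j : ℤ) (s t : ℝ), |s| ≤ |t| → ρ s j ≤ ρ t j)
    (hsol : ∀ (T : ℝ) (j : ℤ), ∀ᶠ n in l, ∀ t ∈ Icc (-T) T,
      HasDerivAt (fun s => (y n s j).1) (y n t j).2 t ∧
        HasDerivAt (fun s => (y n s j).2) (P.force (y n t) j) t) :
    P.IsSolution v := by
  intro j t₀
  set T : ℝ := |t₀| + 1 with hT
  have hT0 : 0 < T := by positivity
  have ht₀ : t₀ ∈ Ioo (-T) T := by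
    constructor
    · linarith [neg_abs_le t₀]
    · linarith [le_abs_self t₀]
  have habsT : ∀ t ∈ Icc (-T) T, |t| ≤ |T| := fun t ht => by
    rw [abs_of_pos hT0]
    exact abs_le.mpr ht
  -- uniform bounds on `[-T, T]`, for the approximants and for the limit
  have hbd : ∀ n, ∀ t ∈ Icc (-T) T, ∀ k : ℤ, |(y n t k).1| ≤ ρ T k ∧ |(y n t k).2| ≤ ρ T k := by
    intro n t ht k
    have h1 : ‖y n t k‖ ≤ ρ T k := (hρ n t k).trans (hρm k t T (habsT t ht))
    exact ⟨le_trans (by simpa using norm_fst_le (y n t k)) h1,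
      le_trans (by simpa using norm_snd_le (y n t k)) h1⟩
  have hbdv : ∀ t ∈ Icc (-T) T, ∀ k : ℤ, |(v t k).1| ≤ ρ T k ∧ |(v t k).2| ≤ ρ T k := by
    intro t ht k
    have h1 : ‖v t k‖ ≤ ρ T k :=
      le_of_tendsto' (hv t k).norm fun n => (hρ n t k).trans (hρm k t T (habsT t ht))
    exact ⟨le_trans (by simpa using norm_fst_le (v t k)) h1,
      le_trans (by simpa using norm_snd_le (v t k)) h1⟩
  -- positions converge uniformly on `[-T, T]`, at every site
  have hq_unif : ∀ k : ℤ, TendstoUniformlyOn (fun n t => (y n t k).1) (fun t => (v t k).1) l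
      (Icc (-T) T) := by
    intro k
    refine tendstoUniformlyOn_of_equilipschitz (L := ρ T k) ?_ fun x _ => (hv x k).fst_nhds
    filter_upwards [hsol T k] with n hn
    intro x hx x' hx'
    have h := (convex_Icc (-T) T).norm_image_sub_le_of_norm_hasDerivWithin_le
      (f := fun s => (y n s k).1) (f' := fun s => (y n s k).2)
      (fun s hs => (hn s hs).1.hasDerivWithinAt)
      (fun s hs => by simpa [Real.norm_eq_abs] using (hbd n s hs k).2) hx' hx
    simpa [dist_eq_norm] using h
  -- the force at site `j` as a continuous function of `(q_{j-1}, q_j, q_{j+1})`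
  set Φ : ℝ × ℝ × ℝ → ℝ := fun z =>
    -deriv P.U z.2.1 + deriv P.V (z.2.2 - z.2.1) - deriv P.V (z.2.1 - z.1) with hΦ
  have hΦc : Continuous Φ :=
    ((hUc.comp continuous_snd.fst).neg.add
      (hVc.comp (continuous_snd.snd.sub continuous_snd.fst))).sub
      (hVc.comp (continuous_snd.fst.sub continuous_fst))
  have hforce : ∀ σ : ChainConfig, P.force σ j = Φ ((σ (j - 1)).1, (σ j).1, (σ (j + 1)).1) :=
    fun σ => by simp only [hΦ, force_eq]
  set Kbox : Set (ℝ × ℝ × ℝ) := Icc (-ρ T (j - 1)) (ρ T (j - 1)) ×ˢ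
    (Icc (-ρ T j) (ρ T j) ×ˢ Icc (-ρ T (j + 1)) (ρ T (j + 1))) with hKbox
  have hKc : IsCompact Kbox := isCompact_Icc.prod (isCompact_Icc.prod isCompact_Icc)
  obtain ⟨M, hM⟩ := hKc.exists_bound_of_continuousOn hΦc.continuousOn
  have hΦu : UniformContinuousOn Φ Kbox := hKc.uniformContinuousOn_of_continuous hΦc.continuousOn
  have hmemK : ∀ n, ∀ t ∈ Icc (-T) T,
      ((y n t (j - 1)).1, (y n t j).1, (y n t (j + 1)).1) ∈ Kbox := by
    intro n t ht
    simp only [hKbox, mem_prod, mem_Icc]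
    exact ⟨abs_le.mp (hbd n t ht _).1, abs_le.mp (hbd n t ht _).1, abs_le.mp (hbd n t ht _).1⟩
  have hmemKv : ∀ t ∈ Icc (-T) T, ((v t (j - 1)).1, (v t j).1, (v t (j + 1)).1) ∈ Kbox := by
    intro t ht
    simp only [hKbox, mem_prod, mem_Icc]
    exact ⟨abs_le.mp (hbdv t ht _).1, abs_le.mp (hbdv t ht _).1, abs_le.mp (hbdv t ht _).1⟩
  -- momenta at site `j` converge uniformly on `[-T, T]` (forces bounded by `M` there)
  have hp_unif : TendstoUniformlyOn (fun n t => (y n t j).2) (fun t => (v t j).2) l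
      (Icc (-T) T) := by
    refine tendstoUniformlyOn_of_equilipschitz (L := M) ?_ fun x _ => (hv x j).snd_nhds
    filter_upwards [hsol T j] with n hn
    intro x hx x' hx'
    have h := (convex_Icc (-T) T).norm_image_sub_le_of_norm_hasDerivWithin_le
      (f := fun s => (y n s j).2) (f' := fun s => P.force (y n s) j)
      (fun s hs => (hn s hs).2.hasDerivWithinAt)
      (fun s hs => by
        rw [hforce]
        exact hM _ (hmemK n s hs)) hx' hx
    simpa [dist_eq_norm] using h
  -- the forces at site `j` converge uniformly on `[-T, T]`
  have hF_unif : TendstoUniformlyOn (fun n t => P.force (y n t) j) (fun t => P.force (v t) j) l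
      (Icc (-T) T) := by
    have h3 := tendstoUniformlyOn_prodMk (hq_unif (j - 1))
      (tendstoUniformlyOn_prodMk (hq_unif j) (hq_unif (j + 1)))
    have h4 := hΦu.comp_tendstoUniformlyOn_eventually (Eventually.of_forall fun n => hmemK n)
      hmemKv h3
    simp_rw [hforce]
    exact h4
  -- derivatives pass to the limit on the open interval `(-T, T) ∋ t₀`
  have hsub : Ioo (-T) T ⊆ Icc (-T) T := Ioo_subset_Icc_self
  refine ⟨?_, ?_⟩
  · exact hasDerivAt_of_tendstoUniformlyOn (f := fun n s => (y n s j).1)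
      (f' := fun n s => (y n s j).2) (g := fun s => (v s j).1) (g' := fun s => (v s j).2)
      isOpen_Ioo (hp_unif.mono hsub)
      ((hsol T j).mono fun n hn x hx => (hn x (hsub hx)).1) (fun x _ => (hv x j).fst_nhds) ht₀
  · exact hasDerivAt_of_tendstoUniformlyOn (f := fun n s => (y n s j).2)
      (f' := fun n s => P.force (y n s) j) (g := fun s => (v s j).2)
      (g' := fun s => P.force (v s) j) isOpen_Ioo (hF_unif.mono hsub)
      ((hsol T j).mono fun n hn x hx => (hn x (hsub hx)).2) (fun x _ => (hv x j).snd_nhds) ht₀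

end Limit

/-! ## Theorem 1 -/

/-- **Lanford–Lebowitz–Lieb 1977, Theorem 1, for the nearest-neighbour chain — proved.**
Discharges the named fact `LanfordLebowitzLieb1977_thm1_chain`: under A2–A4, every initial datum
with `ℒ(0) ∈ B_r` admits a global solution of (1a)–(1c) with `ℒ_j(t) ≤ K' e^{r|j|}` on bounded time
intervals. Proof as printed: severed dynamics in `Λ_n` (`exists_severed_approximant`, with
Lemma 1 = `siteEnergy_sev_le`), compactness (`exists_ultrafilter_tendsto_of_norm_le`, the
diagonal/Arzelà–Ascoli step), passage to the limit (`isSolution_of_tendsto`), and the bound (11)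
from (5) in the limit. [cite: LanfordLebowitzLieb1977, §2 Thm 1] -/
theorem LanfordLebowitzLieb1977_thm1_chain_holds : LanfordLebowitzLieb1977_thm1_chain := by
  intro P hU hV hA3 hA4 r hr σ₀ hσ₀
  obtain ⟨C₁, C₂, hC₁, -, hA3⟩ := hA3
  obtain ⟨K, hK0, A, hA, hA4⟩ := hA4
  obtain ⟨C, hC⟩ := hσ₀
  -- `ℒ_j(σ₀) ≤ B e^{r|j|}` for the shifted (nonnegative) site energies
  set B : ℝ := max (C + |K|) 0 with hBdef
  have hB : ∀ j : ℤ, P.siteEnergy K σ₀ j ≤ B * Real.exp (r * |(j : ℝ)|) := by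
    intro j
    have h1 := hC j
    have h2 : P.siteEnergy K σ₀ j = P.siteEnergy 0 σ₀ j + K := by simp [siteEnergy]
    have h3 : (1 : ℝ) ≤ Real.exp (r * |(j : ℝ)|) := Real.one_le_exp (by positivity)
    have h4 : C + |K| ≤ B := le_max_left _ _
    rw [h2]
    calc P.siteEnergy 0 σ₀ j + K
        ≤ C * Real.exp (r * |(j : ℝ)|) + |K| * Real.exp (r * |(j : ℝ)|) := by
          nlinarith [le_abs_self K, abs_nonneg K]
      _ = (C + |K|) * Real.exp (r * |(j : ℝ)|) := by ring
      _ ≤ B * Real.exp (r * |(j : ℝ)|) := mul_le_mul_of_nonneg_right h4 (Real.exp_pos _).le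
  have hB0 : 0 ≤ B := le_max_right _ _
  set κ : ℝ := 3 * A * Real.exp r with hκ
  have hκ0 : 0 ≤ κ := by positivity
  -- the severed approximants `σ^n`
  choose y hy0 hyE hyD using fun n : ℕ =>
    exists_severed_approximant (σ₀ := σ₀) hU hV hC₁ hA3 hK0 hA hA4 hr.le hB n
  -- pointwise bounds, uniform in `n`
  set ℰ : ℝ → ℤ → ℝ := fun t j => 2 * B * Real.exp (κ * |t|) * Real.exp (r * |(j : ℝ)|) with hℰ
  set ρ : ℝ → ℤ → ℝ := fun t j => max (C₁ * (ℰ t j + |K|) + C₂) (1 + 2 * ℰ t j) with hρ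
  have hρb : ∀ n t j, ‖y n t j‖ ≤ ρ t j := by
    intro n t j
    have hEj : P.siteEnergy K (y n t) j ≤ ℰ t j := hyE n t j
    rw [Prod.norm_def, Real.norm_eq_abs, Real.norm_eq_abs]
    refine max_le_max ?_ ?_
    · exact (abs_fst_le_siteEnergy hC₁ hA3 (y n t) j).trans
        (by nlinarith [mul_le_mul_of_nonneg_left hEj hC₁])
    · exact (abs_snd_le_siteEnergy hK0 (y n t) j).trans (by linarith)
  have hρm : ∀ (j : ℤ) (s t : ℝ), |s| ≤ |t| → ρ s j ≤ ρ t j := by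
    intro j s t hst
    have h1 : ℰ s j ≤ ℰ t j := expBound_mono hB0 hκ0 hr.le hst le_rfl
    exact max_le_max (by nlinarith [mul_le_mul_of_nonneg_left h1 hC₁]) (by linarith)
  -- compactness: a pointwise limit along an ultrafilter
  obtain ⟨𝒰, w, h𝒰, -, hw⟩ := exists_ultrafilter_tendsto_of_norm_le
    (u := fun n (x : ℝ × ℤ) => y n x.1 x.2) (ρ := fun x => ρ x.1 x.2) (fun n x => hρb n x.1 x.2)
  have hw' : ∀ (t : ℝ) (j : ℤ), Tendsto (fun n => y n t j) (𝒰 : Filter ℕ) (𝓝 (w (t, j))) :=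
    fun t j => hw (t, j)
  refine ⟨fun t j => w (t, j), ?_, ?_, ?_⟩
  · -- initial condition: `σ^n(0) = σ₀` for all `n`
    funext j
    have h1 : Tendsto (fun n => y n 0 j) (𝒰 : Filter ℕ) (𝓝 (σ₀ j)) := by
      simp only [hy0]
      exact tendsto_const_nhds
    exact tendsto_nhds_unique (hw' 0 j) h1
  · -- equations of motion
    refine isSolution_of_tendsto (hU.continuous_deriv (by norm_num))
      (hV.continuous_deriv (by norm_num)) hw' hρb hρm fun T j => ?_
    obtain ⟨N, hN⟩ := exists_nat_ge (max T |(j : ℝ)|)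
    have hev : ∀ᶠ n : ℕ in (𝒰 : Filter ℕ), N ≤ n := (eventually_ge_atTop N).filter_mono h𝒰
    filter_upwards [hev] with n hn t ht
    have hNn : (N : ℝ) ≤ n := by exact_mod_cast hn
    have hnT : T ≤ n := (le_max_left _ _).trans (hN.trans hNn)
    have hjn : j ∈ box n := mem_box_of_abs_le ((le_max_right _ _).trans (hN.trans hNn))
    exact hyD n t ⟨by linarith [ht.1], by linarith [ht.2]⟩ j hjn
  · -- the bound `ℒ_j(t) ≤ K' e^{r|j|}` for `|t| ≤ T`
    intro T
    refine ⟨2 * B * Real.exp (κ * |T|) + |K|, fun t ht j => ?_⟩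
    have hEw : P.siteEnergy K (fun k => w (t, k)) j ≤ ℰ t j := by
      have hcont : Continuous fun z : ℝ × ℝ => z.2 ^ 2 / 2 + P.U z.1 + K := by
        have := hU.continuous
        fun_prop
      have h1 : Tendsto (fun n => P.siteEnergy K (y n t) j) (𝒰 : Filter ℕ)
          (𝓝 (P.siteEnergy K (fun k => w (t, k)) j)) := by
        have := (hcont.tendsto (w (t, j))).comp (hw' t j)
        simpa [siteEnergy, Function.comp_def] using this
      exact le_of_tendsto' h1 fun n => hyE n t j
    have h2 : P.siteEnergy 0 (fun k => w (t, k)) j = P.siteEnergy K (fun k => w (t, k)) j - K := by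
      simp [siteEnergy]
    have h3 : ℰ t j ≤ 2 * B * Real.exp (κ * |T|) * Real.exp (r * |(j : ℝ)|) :=
      expBound_mono hB0 hκ0 hr.le (ht.trans (le_abs_self T)) le_rfl
    have h4 : (1 : ℝ) ≤ Real.exp (r * |(j : ℝ)|) := Real.one_le_exp (by positivity)
    show P.siteEnergy 0 (fun k => w (t, k)) j ≤ _
    rw [h2]
    nlinarith [neg_abs_le K, abs_nonneg K]


end OscillatorChain

end Literature.MathematicalPhysics.KineticTheory.HeatConduction

end
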